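import Summits.HodgeConjecture.HodgeConjecture.Theorems.WeilTypeLadderBlochSeed
import Literature.AlgebraicGeometry.HodgeTheory.BlochSemiregularSpreadSmoothComponents
import HarnessLib

/-!
# Venture HSemireg — the REDUCIBLE-cycle door: a Bloch-semiregular reduced local complete intersection with smooth
# components (e.g. Schoen's `Δ_J ∪ (C × C) ⊂ J(C)²`) at ONE anchor ⟹ the local variational clause ⟹ the component

HONEST FRAMING. Lean index of the computation cell `pub-hsemireg`; nothing about any explicit variety is asserted; every
published input is a hypothesis BY NAME. Companion of `Transfer.lean` (door D1: INTEGRAL lci seeds, tree predicate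
`HasBlochSeedAt`, transport `BlochSemiregularSpread`). The cell's STEP-0 object (class (A): Schoen's cycle `Δ_J ∪ (C × C)` on
`J(C)²`, `C` of genus `2`, `K = ℚ(√-3)`; semiregular by the cell's exact computation `rank π = 12 = h¹(N_Z)`) and its Prong-C
objects (`Δ_B ∪ T ⊂ B × B`) are REDUCIBLE, so they cannot enter `HasBlochSeedAt` (which asks `Z` integral in order to pin the
class by support and purity). Bloch's theorem assumes only a local complete intersection; the transport fact for a REDUCED lci
with SMOOTH components, class pinned by the tree's REAL fundamental class `Σ_j ι_{j*}1` (complex orientations), is the named fact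
`BlochSemiregularSpreadSmoothComponents` (`Literature/…/BlochSemiregularSpreadSmoothComponents.lean`, Bloch (7.4)/(7.5) =
Buchweitz–Flenner Thm. 5.2, REFEREED). This file:

* `HasBlochUnionSeedAt n P h w` (PREDICATE): smooth projective `n`-folds `K_j ↪ P` (pairwise distinct images), a REDUCED closed
  lci `Z ↪ P` of codimension `n` with `|Z| = ⋃ |K_j|`, Bloch-semiregular (`IsBlochSemiregular i (2n) n`), and rationals `q`,
  `μ ≠ 0` with `q·hⁿ + w = μ·Σ_j [K_j]`.
* `weilAnchorLocalClause_of_blochSpreadSmoothComponents_of_unionSeedAt` (PROVED): fact ∧ union seed ⟹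
  `WeilAnchorLocalClause n d P h w` (every `d`).
* `weilClasses_algebraic_of_similar_unionSeed`, `weilClasses_algebraic_split_of_hyperbolic_unionSeed`: the anchor's component
  (reach-by-similitude) and the split component (hyperbolic reach) from ONE union seed — the STEP-0 class (A) shape at `n = 2`.

References: [Bloch1972Semiregularity] Thm. (7.4), Remark (7.5); [BuchweitzFlenner2003] Thm. 5.2; [Deligne1982HodgeCycles]
proof of Thm. 4.8; C. Schoen, Compositio Math. 65 (1988) (the cycle `Δ ∪ C × C` for `ℚ(√-3)`-Weil fourfolds).
-/

noncomputable section

open CategoryTheory CategoryTheory.Limits AlgebraicGeometry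
open Literature.AlgebraicTopology.SingularHomology

namespace Summit.Ventures.HSemireg

open Literature.AlgebraicGeometry Literature.AlgebraicGeometry.Motives
open Literature.AlgebraicGeometry.HodgeTheory
open Literature.AlgebraicTopology.SingularHomology
open Summit.HodgeConjecture.HodgeConjecture.WeilTypeLadder

/-- **A Bloch UNION seed for `q·hⁿ + w` on the abelian `2n`-fold `P`** (PREDICATE, nothing asserted; design input):
finitely many smooth projective `n`-folds `K_j` with closed immersions `ι_j : K_j ↪ P` of pairwise distinct images, a
REDUCED closed local complete intersection `i : Z ↪ P` of codimension `n` with `|Z| = ⋃_j |ι_j(K_j)|` which is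
Bloch-semiregular in `P` read as a `2n`-fold (`IsBlochSemiregular i (2n) n`), and rationals `q`, `μ ≠ 0` with
`q·hⁿ + w = μ · Σ_j [K_j]` (`[K_j] = ι_{j*}1`, complex orientations: the REAL fundamental class of the reduced `Z`).
Bloch's hypothesis of (7.4) in the form (7.5) for a REDUCIBLE lci (e.g. Schoen's `Δ_J ∪ (C × C) ⊂ J(C)²`); companion
of the tree's `HasBlochSeedAt` (integral `Z`). [cite: Bloch1972Semiregularity, Thm. (7.4) and Remark (7.5)]
[cite: FultonYoungTableaux1997, Appendix B §B.3] -/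
def HasBlochUnionSeedAt (n : ℕ) (P : AbelianVariety ℂ) (h : complexBetti P.X 2) (w : complexBetti P.X (2 * n)) : Prop :=
  ∃ (hP : IsSmoothProjective (2 * n) P.X) (r : ℕ) (K : Fin r → SchemeOver ℂ) (hK : ∀ j, IsSmoothProjective n (K j))
    (ι : ∀ j, K j ⟶ P.X) (Z : Scheme.{0}) (i : Z ⟶ P.X.left) (q μ : ℚ),
    (∀ j, IsClosedImmersion (ι j).left) ∧
    (∀ j j', Set.range (ι j).left.base = Set.range (ι j').left.base → j = j') ∧
    IsRegularImmersionOfCodim i n ∧ IsReduced Z ∧ Set.range i.base = ⋃ j, Set.range (ι j).left.base ∧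
    IsBlochSemiregular i (2 * n) n ∧ μ ≠ 0 ∧
    ((q : ℚ) : ℂ) • cupPowTwo h n + w =
      ((μ : ℚ) : ℂ) • ∑ j, smoothSubvarietyClass (show n + n = 2 * n by omega) (hK j) hP (ι j)

/-- **(L) for union seeds: Bloch's theorem (reduced lci, smooth components) at the anchor gives the local clause.**
Granting `BlochSemiregularSpreadSmoothComponents (2n) n`, a union seed for `q·hⁿ + w` on `P` yields
`WeilAnchorLocalClause n d P h w` for every `d`: along any family of the clause with global `H`, `W` and chart
`e' : P ≅ 𝒳_{s₀}`, the global class `μ⁻¹·(q·Hⁿ + W)` is fibrewise rational of type `(n,n)` and restricts on the anchor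
to `Σ_j [K_j] = [Z]`, so it is algebraic over an open `U ∋ s₀`, hence so is `q·Hⁿ + W`.
[cite: Bloch1972Semiregularity, Thm. (7.4) and Remark (7.5)] [cite: BuchweitzFlenner2003, Thm. 5.2] -/
theorem weilAnchorLocalClause_of_blochSpreadSmoothComponents_of_unionSeedAt {n : ℕ} (d : ℕ)
    (hB : BlochSemiregularSpreadSmoothComponents (2 * n) n) {P : AbelianVariety ℂ} {h : complexBetti P.X 2}
    {w : complexBetti P.X (2 * n)} (hS : HasBlochUnionSeedAt n P h w) : WeilAnchorLocalClause n d P h w := by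
  obtain ⟨hP, r, K, hK, ι, Z, i, q, μ, hι, hdist, hreg, hred, hrange, hsr, hμ, hclass⟩ := hS
  intro 𝒳 S f hf h𝒳qp hSqp _ hsm _ H W hH hW s₀ e' hH₀ hW₀
  -- the global classes `B = q·Hⁿ + W` and `B' = μ⁻¹·B`, their fibre restrictions
  set B : complexBetti 𝒳 (2 * n) := ((q : ℚ) : ℂ) • cupPowTwo H n + W with hBdef
  have hres : ∀ s : ComplexPoints S, complexBetti.map (fiberι f s) (2 * n) B =
      ((q : ℚ) : ℂ) • cupPowTwo (complexBetti.map (fiberι f s) 2 H) n + complexBetti.map (fiberι f s) (2 * n) W := by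
    intro s
    rw [hBdef, map_add, map_smul, complexBetti_map_cupPowTwo']
  have hBrat : ∀ s : ComplexPoints S, IsRationalClass (complexBetti.map (fiberι f s) (2 * n) B) ∧
      IsOfHodgeType (2 * n) (fiberOver f s) (2 * n) n n (complexBetti.map (fiberι f s) (2 * n) B) := by
    intro s
    rw [hres]
    exact ⟨(((hH s).1.cupPowTwo n).smul q).add (hW s).1,
      ((isOfHodgeType_cupPowTwo (hf.isSmoothProjective s) (hH s).2 n).smul _).add (hf.isSmoothProjective s) (hW s).2⟩
  set B' : complexBetti 𝒳 (2 * n) := ((μ⁻¹ : ℚ) : ℂ) • B with hB'def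
  have hres' : ∀ s : ComplexPoints S, complexBetti.map (fiberι f s) (2 * n) B' =
      ((μ⁻¹ : ℚ) : ℂ) • complexBetti.map (fiberι f s) (2 * n) B := by
    intro s
    rw [hB'def, map_smul]
  have hB'rat : ∀ s : ComplexPoints S, IsRationalClass (complexBetti.map (fiberι f s) (2 * n) B') ∧
      IsOfHodgeType (2 * n) (fiberOver f s) (2 * n) n n (complexBetti.map (fiberι f s) (2 * n) B') := by
    intro s
    rw [hres']
    exact ⟨(hBrat s).1.smul μ⁻¹, (hBrat s).2.smul _⟩
  -- the anchoring: `e'^* B'_{s₀} = Σ_j [K_j]`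
  have hx : complexBetti.map e'.hom (2 * n) (complexBetti.map (fiberι f s₀) (2 * n) B') =
      ∑ j, smoothSubvarietyClass (show n + n = 2 * n by omega) (hK j) hP (ι j) := by
    rw [hres', map_smul, hres, map_add, map_smul, complexBetti_map_cupPowTwo', hH₀, hW₀, hclass, smul_smul,
      ← Rat.cast_mul, inv_mul_cancel₀ hμ, Rat.cast_one, one_smul]
  -- Bloch's theorem (reduced lci, smooth components), class level
  obtain ⟨U, hUo, hs₀U, hU⟩ :=
    hB n (by omega) P.X hP r K hK ι Z i 𝒳 S f s₀ e' B' hι hdist hreg hred hrange hsr hf h𝒳qp hSqp hsm hB'rat hx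
  refine ⟨U, q, hUo, hs₀U, fun s hs => ?_⟩
  have halg : ((μ : ℚ) : ℂ) • complexBetti.map (fiberι f s) (2 * n) B' ∈ algebraicClasses (fiberOver f s) n :=
    Submodule.smul_mem _ _ (hU s hs)
  rw [hres', smul_smul, ← Rat.cast_mul, mul_inv_cancel₀ hμ, Rat.cast_one, one_smul, hres] at halg
  exact halg

/-- **The anchor's component from one UNION seed** (reduced lci with smooth components, e.g. Schoen's
`Δ_J ∪ (C × C)`): granting `BlochSemiregularSpreadSmoothComponents (2n) n` (Bloch (7.4)/(7.5), refereed) and Deligne's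
reach-by-similitude `weilFamilyReach_similar` (refereed), an anchor `(P, ψ₀, ι, a)` (`n, d ≥ 1`) with a non-zero rational
`(n,n)` Weil class `w` and a union seed for `q·h_Kⁿ + w` makes the Weil plane of every `√-d`-Weil abelian `2n`-fold with a
non-zero `(n,n)` Weil class that is Weil-similar to the anchor algebraic. [cite: Bloch1972Semiregularity, Thm. (7.4) and Remark (7.5)]
[cite: Deligne1982HodgeCycles, proof of Thm. 4.8] -/
theorem weilClasses_algebraic_of_similar_unionSeed {n d : ℕ} (hn : 1 ≤ n) (hd : 1 ≤ d)
    (hB : BlochSemiregularSpreadSmoothComponents (2 * n) n) (hF : weilFamilyReach_similar)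
    (P : AbelianVariety ℂ) (ψ₀ : P ⟶ P) (ι : ProjectiveEmbedding P.X) (a : complexBetti (projectiveSpace ι.n ℂ) 2)
    (w : complexBetti P.X (2 * n)) (hP : P.dim = 2 * n) (hψ : ψ₀ ≫ ψ₀ = -(d • 𝟙 P)) (ha : IsRationalClass a)
    (ha0 : a ≠ 0) (hwW : w ∈ weilClassesOf P ψ₀ n d) (hwr : IsRationalClass w) (hw0 : w ≠ 0)
    (hwH : IsOfHodgeType (2 * n) P.X (2 * n) n n w)
    (hS : HasBlochUnionSeedAt n P ((d : ℂ) • complexBetti.map ι.ι 2 a + complexBetti.map ψ₀.hom.hom.hom 2 (complexBetti.map ι.ι 2 a)) w)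
    (A : AbelianVariety ℂ) (φ : A ⟶ A) (hA : A.dim = 2 * n) (hφ : φ ≫ φ = -(d • 𝟙 A))
    (hWA : ∃ wA : complexBetti A.X (2 * n),
      wA ∈ weilClassesOf A φ n d ∧ wA ≠ 0 ∧ IsOfHodgeType (2 * n) A.X (2 * n) n n wA)
    (eA : ProjectiveEmbedding A.X) (aA : complexBetti (projectiveSpace eA.n ℂ) 2) (haA : IsRationalClass aA)
    (haA0 : aA ≠ 0)
    (hsim : IsWeilSimilar n P ψ₀
      ((d : ℂ) • complexBetti.map ι.ι 2 a + complexBetti.map ψ₀.hom.hom.hom 2 (complexBetti.map ι.ι 2 a)) A φ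
      ((d : ℂ) • complexBetti.map eA.ι 2 aA + complexBetti.map φ.hom.hom.hom 2 (complexBetti.map eA.ι 2 aA))) :
    weilClassesOf A φ n d ≤ algebraicClasses A.X n :=
  weilClassesOf_le_algebraicClasses_of_reachSimilar_of_similarAnchor hF hn hd A φ hA hφ hWA
    ⟨eA, aA, P, ψ₀, ι, a, w, haA, haA0, hP, hψ, ha, ha0, hwW, hwr, hw0, hwH,
      weilAnchorLocalClause_of_blochSpreadSmoothComponents_of_unionSeedAt d hB hS, hsim⟩

/-- **The split component from one UNION seed on a SPLIT anchor** (`n, d ≥ 1`): `BlochSemiregularSpreadSmoothComponents (2n) n`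
∧ `weilFamilyReach_hyperbolic` (both refereed) ∧ a union seed for `q·h_Kⁿ + w` at a hyperbolic anchor with `w ≠ 0` a rational
Weil class ⟹ the Weil plane of EVERY split `√-d`-Weil abelian `2n`-fold is algebraic. At `n = 2` with the anchor `J(C)²`,
`C` of genus `2`, `K = ℚ(√-3)`, and Schoen's `Z = Δ_J ∪ (C × C)`: the cell's STEP-0 class (A) in Lean shape.
[cite: Bloch1972Semiregularity, Thm. (7.4) and Remark (7.5)] [cite: Deligne1982HodgeCycles, proof of Thm. 4.8] -/
theorem weilClasses_algebraic_split_of_hyperbolic_unionSeed (n d : ℕ) (hn : 1 ≤ n) (hd : 1 ≤ d)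
    (hB : BlochSemiregularSpreadSmoothComponents (2 * n) n) (hF : weilFamilyReach_hyperbolic)
    (P : AbelianVariety ℂ) (ψ₀ : P ⟶ P) (ι : ProjectiveEmbedding P.X) (a : complexBetti (projectiveSpace ι.n ℂ) 2)
    (w : complexBetti P.X (2 * n)) (hP : P.dim = 2 * n) (hψ : ψ₀ ≫ ψ₀ = -(d • 𝟙 P)) (ha : IsRationalClass a)
    (ha0 : a ≠ 0)
    (hhyp : IsHyperbolicWeilType P ψ₀ n
      ((d : ℂ) • complexBetti.map ι.ι 2 a + complexBetti.map ψ₀.hom.hom.hom 2 (complexBetti.map ι.ι 2 a)))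
    (hwW : w ∈ weilClassesOf P ψ₀ n d) (hwr : IsRationalClass w) (hw0 : w ≠ 0)
    (hS : HasBlochUnionSeedAt n P ((d : ℂ) • complexBetti.map ι.ι 2 a + complexBetti.map ψ₀.hom.hom.hom 2 (complexBetti.map ι.ι 2 a)) w)
    (A : AbelianVariety ℂ) (φ : A ⟶ A) (hA : A.dim = 2 * n) (hφ : φ ≫ φ = -(d • 𝟙 A))
    (eA : ProjectiveEmbedding A.X) (aA : complexBetti (projectiveSpace eA.n ℂ) 2) (haA : IsRationalClass aA)
    (haA0 : aA ≠ 0)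
    (hhypA : IsHyperbolicWeilType A φ n
      ((d : ℂ) • complexBetti.map eA.ι 2 aA + complexBetti.map φ.hom.hom.hom 2 (complexBetti.map eA.ι 2 aA))) :
    weilClassesOf A φ n d ≤ algebraicClasses A.X n :=
  weilClasses_algebraic_hyperbolic_of_localAnchor n d hn hd
    ((hasLocallyAlgebraicWeilAnchor_iff n d).2
      ⟨P, ψ₀, ι, a, w, hP, hψ, ha, ha0, hhyp, hwW, hwr, hw0,
        weilAnchorLocalClause_of_blochSpreadSmoothComponents_of_unionSeedAt d hB hS⟩)
    hF A φ hA hφ eA aA haA haA0 hhypA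


end Summit.Ventures.HSemireg

end
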